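import Mathlib

/-!
# Binary forms over a commutative ring: coefficients under upper triangular substitutions, and the
# PROTOMORPH seminvariants (crux `ValuativeGCT.ValuativeFlip`, stmt-ValiantsHypothesis-12624;
# wall-breaker axis k13 "explicit padded-permanent highest-weight vectors for seedRichness", part B)

Pure commutative algebra used by the explicit two-row highest-weight vectors of the padded permanent.
A binary form of degree `m` over a commutative ring `R` is `g = ∑_j b_j s^j t^{m-j} ∈ R[s, t]`
(`s = X 0`, `t = X 1`; `bcoeff m j g = b_j`).  The upper triangular substitution
`s ↦ α s`, `t ↦ β s + γ t` (`upperSubst α β γ`; this is how the inverse of an upper triangular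
`b ∈ GL₂` acts on the last-two-letters restriction of a form, the greater letter `t` absorbing the
smaller one) changes the coefficients by the explicit rule `bcoeff_aeval_upperSubst`:
`b'_j = ∑_{i ≤ j} b_i α^i β^{j-i} γ^{m-j} C(m-i, j-i)`.

The **protomorph construction** (classical invariant theory: Cayley, Sylvester; Elliott, *Algebra of
Quantics* (1913) §§127–131 "seminvariants as functions of the protomorphs"; Hilbert, *Theory of
Algebraic Invariants*, Lecture I.8): normalise away the coefficient of `s t^{m-1}` by the Tschirnhaus
substitution `t ↦ t - (b₁/(m b₀)) s`, cleared of denominators by `s ↦ m b₀ s`: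
`proto m g = g(m b₀ s, t - b₁ s)`.  Because a further upper triangular substitution of `g` is
absorbed by this normalisation (`proto_aeval_upperSubst`: `proto (g ∘ c) = γ^m · (proto g)(α γ^{m-1} s, t)`),
every coefficient `P_j(g) = bcoeff m j (proto m g)` is a SEMI-INVARIANT:
`P_j(g ∘ c) = γ^m (α γ^{m-1})^j P_j(g)` (`bcoeff_proto_aeval_upperSubst`), of degree `j + 1` in the `b`'s,
with the explicit expansion `P_j = ∑_{i ≤ j} b_i (m b₀)^i (-b₁)^{j-i} C(m-i, j-i)` (`bcoeff_proto`), so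
`P_0 = b₀`, `P_1 = 0`, and `P_j = b_j (m b₀)^j + (terms in b₀, …, b_{j-1})` for `j ≥ 2`.
-/

set_option linter.dupNamespace false

namespace Summit.ValiantsHypothesis.ValiantsHypothesis.Theorems.ValuativeFlip

open MvPolynomial
open scoped BigOperators

noncomputable section

section Binary

variable {R : Type*} [CommRing R]

/-- The exponent vector of the monomial `s^j t^{m-j}` of a binary form of degree `m`. [folklore] -/
def bexp (m j : ℕ) : Fin 2 →₀ ℕ :=
  Finsupp.single 0 j + Finsupp.single 1 (m - j)

/-- The coefficient `b_j` of `s^j t^{m-j}` in a binary form of degree `m`. [folklore] -/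
def bcoeff (m j : ℕ) (g : MvPolynomial (Fin 2) R) : R :=
  coeff (bexp m j) g

/-- The upper triangular substitution `s ↦ α s`, `t ↦ β s + γ t` of the two letters `s = X 0 < t = X 1`
(the greater letter absorbs the smaller one). [folklore] -/
def upperSubst (α β γ : R) : Fin 2 → MvPolynomial (Fin 2) R :=
  ![C α * X 0, C β * X 0 + C γ * X 1]

/-- **The protomorph normalisation** `proto m g = g(m b₀ s, t - b₁ s)` (`b₀, b₁` the coefficients of
`t^m` and `s t^{m-1}` in `g`): the Tschirnhaus substitution killing the coefficient of `s t^{m-1}`,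
cleared of denominators.  Its coefficients are the protomorph seminvariants. [folklore] -/
def proto (m : ℕ) (g : MvPolynomial (Fin 2) R) : MvPolynomial (Fin 2) R :=
  aeval (upperSubst ((m : R) * bcoeff m 0 g) (-bcoeff m 1 g) 1) g

/-- The first letter of `upperSubst`. [folklore] -/
@[simp] theorem upperSubst_zero (α β γ : R) : upperSubst α β γ 0 = C α * X 0 := rfl

/-- The second letter of `upperSubst`. [folklore] -/
@[simp] theorem upperSubst_one (α β γ : R) : upperSubst α β γ 1 = C β * X 0 + C γ * X 1 := rfl

/-- The `s`-exponent of `bexp m j` is `j`. [folklore] -/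
theorem bexp_apply_zero (m j : ℕ) : bexp m j 0 = j := by
  simp [bexp]

/-- The `t`-exponent of `bexp m j` is `m - j`. [folklore] -/
theorem bexp_apply_one (m j : ℕ) : bexp m j 1 = m - j := by
  simp [bexp]

/-- A monomial `s^j t^k` as a `monomial`. [folklore] -/
theorem X_pow_mul_X_pow (j k : ℕ) :
    (X 0 ^ j * X 1 ^ k : MvPolynomial (Fin 2) R) = monomial (Finsupp.single 0 j + Finsupp.single 1 k) 1 := by
  rw [X_pow_eq_monomial, X_pow_eq_monomial, monomial_mul, mul_one]

/-- An exponent vector of degree `m` in two letters is `bexp m (d 0)`. [folklore] -/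
theorem eq_bexp_of_degree {m : ℕ} {d : Fin 2 →₀ ℕ} (hd : d.degree = m) : d = bexp m (d 0) := by
  rw [Finsupp.degree_eq_sum, Fin.sum_univ_two] at hd
  ext i
  fin_cases i
  · simp [bexp]
  · simp [bexp]
    omega

/-- `bexp m j` has degree `m` for `j ≤ m`. [folklore] -/
theorem degree_bexp {m j : ℕ} (hj : j ≤ m) : (bexp m j).degree = m := by
  rw [Finsupp.degree_eq_sum, Fin.sum_univ_two, bexp_apply_zero, bexp_apply_one]
  omega

/-- The coefficient of `s^{j'} t^{m-j'}` in `a · s^j t^{m-j}`. [folklore] -/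
theorem coeff_bexp_C_mul_X_pow_mul_X_pow {m j j' : ℕ} (hj : j ≤ m) (a : R) :
    coeff (bexp m j') (C a * X 0 ^ j * X 1 ^ (m - j)) = if j' = j then a else 0 := by
  rw [mul_assoc, X_pow_mul_X_pow, C_mul_monomial, mul_one, coeff_monomial]
  by_cases h : j' = j
  · subst h
    rw [if_pos rfl, if_pos (show Finsupp.single (0 : Fin 2) j' + Finsupp.single 1 (m - j') = bexp m j'
      from rfl)]
  · rw [if_neg h, if_neg]
    intro heq
    apply h
    have h0 := congrArg (fun d : Fin 2 →₀ ℕ => d 0) heq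
    simp only [Finsupp.coe_add, Pi.add_apply, Finsupp.single_apply, bexp_apply_zero] at h0
    have := hj
    simpa using h0.symm

/-- **A binary form of degree `m` is the sum of its `m + 1` coefficients times monomials.**
[folklore] -/
theorem eq_sum_bcoeff {m : ℕ} {g : MvPolynomial (Fin 2) R} (hg : g.IsHomogeneous m) :
    g = ∑ j ∈ Finset.range (m + 1), C (bcoeff m j g) * X 0 ^ j * X 1 ^ (m - j) := by
  ext d
  rw [coeff_sum]
  have hterm : ∀ j ∈ Finset.range (m + 1), coeff d (C (bcoeff m j g) * X 0 ^ j * X 1 ^ (m - j)) =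
      if bexp m j = d then bcoeff m j g else 0 := by
    intro j _
    rw [mul_assoc, X_pow_mul_X_pow, C_mul_monomial, mul_one, coeff_monomial]
    rfl
  rw [Finset.sum_congr rfl hterm]
  by_cases hdeg : d.degree = m
  · have hd := eq_bexp_of_degree hdeg
    have hd0 : d 0 ≤ m := by rw [Finsupp.degree_eq_sum, Fin.sum_univ_two] at hdeg; omega
    rw [Finset.sum_eq_single (d 0)]
    · rw [if_pos hd.symm, bcoeff, ← hd]
    · intro j _ hj
      rw [if_neg]
      intro h
      apply hj
      rw [← h, bexp_apply_zero]
    · intro h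
      exact absurd (Finset.mem_range.mpr (Nat.lt_succ_of_le hd0)) h
  · rw [hg.coeff_eq_zero hdeg]
    refine (Finset.sum_eq_zero fun j hj => ?_).symm
    rw [if_neg]
    intro h
    apply hdeg
    rw [← h]
    exact degree_bexp (Nat.lt_succ_iff.mp (Finset.mem_range.mp hj))

/-- Homogeneity of the substituted form: an upper triangular substitution maps forms of degree `m` to
forms of degree `m`. [folklore] -/
theorem isHomogeneous_aeval_upperSubst {m : ℕ} {g : MvPolynomial (Fin 2) R} (hg : g.IsHomogeneous m)
    (α β γ : R) : (aeval (upperSubst α β γ) g).IsHomogeneous m := by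
  have h := hg.aeval (upperSubst α β γ) (n := 1) (fun i => by
    fin_cases i
    · exact (isHomogeneous_C _ α).mul (isHomogeneous_X R 0)
    · exact ((isHomogeneous_C _ β).mul (isHomogeneous_X R 0)).add
        ((isHomogeneous_C _ γ).mul (isHomogeneous_X R 1)))
  rwa [one_mul] at h

/-- **Coefficients under an upper triangular substitution.**  For a binary form
`g = ∑ b_i s^i t^{m-i}` of degree `m` and `j ≤ m`, the coefficient of `s^j t^{m-j}` in
`g(α s, β s + γ t)` is `∑_{i ≤ j} b_i α^i β^{j-i} γ^{m-j} C(m-i, j-i)`. [folklore] -/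
theorem bcoeff_aeval_upperSubst {m : ℕ} {g : MvPolynomial (Fin 2) R} (hg : g.IsHomogeneous m)
    (α β γ : R) {j : ℕ} (hj : j ≤ m) :
    bcoeff m j (aeval (upperSubst α β γ) g) =
      ∑ i ∈ Finset.range (j + 1),
        bcoeff m i g * α ^ i * β ^ (j - i) * γ ^ (m - j) * ((m - i).choose (j - i) : R) := by
  -- expand `g` and substitute
  conv_lhs => rw [eq_sum_bcoeff hg, map_sum]
  have hterm : ∀ i ∈ Finset.range (m + 1),
      aeval (upperSubst α β γ) (C (bcoeff m i g) * X 0 ^ i * X 1 ^ (m - i)) =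
        ∑ l ∈ Finset.range (m - i + 1),
          C (bcoeff m i g * α ^ i * β ^ l * γ ^ (m - i - l) * ((m - i).choose l : R)) *
            X 0 ^ (i + l) * X 1 ^ (m - (i + l)) := by
    intro i hi
    have him : i ≤ m := Nat.lt_succ_iff.mp (Finset.mem_range.mp hi)
    rw [map_mul, map_mul, map_pow, map_pow, aeval_C, algebraMap_eq, aeval_X, aeval_X,
      upperSubst_zero, upperSubst_one, add_pow, Finset.mul_sum]
    refine Finset.sum_congr rfl fun l hl => ?_
    have hlm : l ≤ m - i := Nat.lt_succ_iff.mp (Finset.mem_range.mp hl)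
    have hsub : m - (i + l) = m - i - l := by omega
    rw [hsub, mul_pow, mul_pow, mul_pow, ← C_pow, ← C_pow, ← C_pow, map_mul, map_mul, map_mul,
      map_mul, map_natCast, pow_add]
    ring
  rw [Finset.sum_congr rfl hterm]
  -- extract the coefficient of `s^j t^{m-j}`
  rw [bcoeff, coeff_sum]
  simp_rw [coeff_sum]
  have hinner : ∀ i ∈ Finset.range (m + 1),
      ∑ l ∈ Finset.range (m - i + 1), coeff (bexp m j)
        (C (bcoeff m i g * α ^ i * β ^ l * γ ^ (m - i - l) * ((m - i).choose l : R)) *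
          X 0 ^ (i + l) * X 1 ^ (m - (i + l))) =
        if i ≤ j then bcoeff m i g * α ^ i * β ^ (j - i) * γ ^ (m - j) * ((m - i).choose (j - i) : R)
        else 0 := by
    intro i hi
    have him : i ≤ m := Nat.lt_succ_iff.mp (Finset.mem_range.mp hi)
    have hcoef : ∀ l ∈ Finset.range (m - i + 1), coeff (bexp m j)
        (C (bcoeff m i g * α ^ i * β ^ l * γ ^ (m - i - l) * ((m - i).choose l : R)) *
          X 0 ^ (i + l) * X 1 ^ (m - (i + l))) =
        if l = j - i ∧ i ≤ j then
          bcoeff m i g * α ^ i * β ^ (j - i) * γ ^ (m - j) * ((m - i).choose (j - i) : R)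
        else 0 := by
      intro l hl
      have hlm : l ≤ m - i := Nat.lt_succ_iff.mp (Finset.mem_range.mp hl)
      rw [coeff_bexp_C_mul_X_pow_mul_X_pow (m := m) (j := i + l) (j' := j) (by omega)]
      by_cases h : l = j - i ∧ i ≤ j
      · obtain ⟨rfl, hij⟩ := h
        rw [if_pos (by omega), if_pos ⟨rfl, hij⟩]
        have : m - i - (j - i) = m - j := by omega
        rw [this]
      · rw [if_neg h, if_neg]
        omega
    rw [Finset.sum_congr rfl hcoef]
    by_cases hij : i ≤ j
    · rw [if_pos hij, Finset.sum_eq_single (j - i)]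
      · rw [if_pos ⟨rfl, hij⟩]
      · intro l _ hl
        rw [if_neg]
        exact fun h => hl h.1
      · intro h
        exact absurd (Finset.mem_range.mpr (by omega)) h
    · rw [if_neg hij]
      exact Finset.sum_eq_zero fun l _ => by rw [if_neg]; exact fun h => hij h.2
  rw [Finset.sum_congr rfl hinner]
  -- restrict the outer sum to `i ≤ j`
  rw [← Finset.sum_filter]
  have hfilter : (Finset.range (m + 1)).filter (fun i => i ≤ j) = Finset.range (j + 1) := by
    ext i
    simp only [Finset.mem_filter, Finset.mem_range]
    omega
  rw [hfilter]

/-- The coefficient of `t^m` is unchanged up to `γ^m`: `b'_0 = γ^m b_0`. [folklore] -/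
theorem bcoeff_zero_aeval_upperSubst {m : ℕ} {g : MvPolynomial (Fin 2) R} (hg : g.IsHomogeneous m)
    (α β γ : R) : bcoeff m 0 (aeval (upperSubst α β γ) g) = γ ^ m * bcoeff m 0 g := by
  rw [bcoeff_aeval_upperSubst hg α β γ (Nat.zero_le m), Finset.sum_range_one]
  simp [mul_comm]

/-- The coefficient of `s t^{m-1}`: `b'_1 = α γ^{m-1} b_1 + m β γ^{m-1} b_0`. [folklore] -/
theorem bcoeff_one_aeval_upperSubst {m : ℕ} (hm : 1 ≤ m) {g : MvPolynomial (Fin 2) R}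
    (hg : g.IsHomogeneous m) (α β γ : R) :
    bcoeff m 1 (aeval (upperSubst α β γ) g) =
      α * γ ^ (m - 1) * bcoeff m 1 g + (m : R) * β * γ ^ (m - 1) * bcoeff m 0 g := by
  rw [bcoeff_aeval_upperSubst hg α β γ hm, Finset.sum_range_succ, Finset.sum_range_one]
  simp only [Nat.sub_zero, pow_zero, mul_one, pow_one, Nat.choose_one_right, Nat.sub_self,
    Nat.choose_zero_right, Nat.cast_one]
  ring

/-- Scaling the variables of an algebra homomorphism scales its value on a form of degree `D` by the
`D`-th power (adapted from `PlethysmLifting.algHom_apply_eq_pow_smul_of_isHomogeneous`, over a ring).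
[folklore] -/
theorem aeval_C_mul_eq_pow_mul {ι : Type*} (w : ι → MvPolynomial (Fin 2) R) (c : R)
    {F : MvPolynomial ι R} {D : ℕ} (hF : F.IsHomogeneous D) :
    aeval (fun i => C c * w i) F = C c ^ D * aeval w F := by
  classical
  have h1 : ∀ (φ : ι → MvPolynomial (Fin 2) R) (s : ι →₀ ℕ) (r : R),
      aeval φ (monomial s r) = C r * s.prod fun d e => φ d ^ e := by
    intro φ s r
    rw [aeval_monomial, algebraMap_eq]
  conv_lhs => rw [← F.support_sum_monomial_coeff]
  conv_rhs => rw [← F.support_sum_monomial_coeff]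
  rw [map_sum, map_sum, Finset.mul_sum]
  refine Finset.sum_congr rfl fun s hs => ?_
  rw [h1, h1]
  have hdeg : (s.sum fun _ e => e) = D := by
    have := hF (mem_support_iff.mp hs)
    simpa [Finsupp.weight_apply] using this
  rw [← hdeg, Finsupp.prod, Finsupp.prod, Finsupp.sum, ← Finset.prod_pow_eq_pow_sum, mul_left_comm,
    ← Finset.prod_mul_distrib]
  congr 1
  exact Finset.prod_congr rfl fun d _ => by rw [mul_pow]

/-- **The protomorph normalisation absorbs upper triangular substitutions.**  For a binary form `g`
of degree `m ≥ 1` and `c = (α, β; 0, γ)`: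
`proto (g(αs, βs + γt)) = γ^m · (proto g)(α γ^{m-1} s, t)`.
Proof: both sides are `g` composed with a substitution; the two substitutions agree letter by letter
(`b'_0 = γ^m b_0`, `b'_1 = α γ^{m-1} b_1 + m β γ^{m-1} b_0`), up to the common factor `γ` pulled out
by homogeneity. [folklore] -/
theorem proto_aeval_upperSubst {m : ℕ} (hm : 1 ≤ m) {g : MvPolynomial (Fin 2) R}
    (hg : g.IsHomogeneous m) (α β γ : R) :
    proto m (aeval (upperSubst α β γ) g) =
      C γ ^ m * aeval (upperSubst (α * γ ^ (m - 1)) 0 1) (proto m g) := by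
  have h0 := bcoeff_zero_aeval_upperSubst hg α β γ
  have h1 := bcoeff_one_aeval_upperSubst hm hg α β γ
  have hγ : (γ : R) ^ m = γ * γ ^ (m - 1) := by
    rw [← pow_succ', Nat.sub_add_cancel hm]
  -- both sides as substitutions of `g`
  rw [proto, proto, comp_aeval_apply, comp_aeval_apply, h0, h1]
  set W : Fin 2 → MvPolynomial (Fin 2) R := fun i =>
    aeval (upperSubst (α * γ ^ (m - 1)) 0 1)
      (upperSubst ((m : R) * bcoeff m 0 g) (-bcoeff m 1 g) 1 i) with hW
  have hφ : (fun i => aeval (upperSubst ((m : R) * (γ ^ m * bcoeff m 0 g))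
      (-(α * γ ^ (m - 1) * bcoeff m 1 g + (m : R) * β * γ ^ (m - 1) * bcoeff m 0 g)) 1)
      (upperSubst α β γ i)) = fun i => C γ * W i := by
    funext i
    fin_cases i
    · simp only [hW, Fin.zero_eta, Fin.isValue, upperSubst_zero, map_mul, aeval_C, algebraMap_eq,
        aeval_X, hγ, map_natCast, map_pow]
      ring
    · simp only [hW, Fin.mk_one, Fin.isValue, upperSubst_one, upperSubst_zero, map_add, map_mul,
        aeval_C, algebraMap_eq, aeval_X, hγ, map_natCast, map_pow, map_neg, map_one, map_zero]
      ring
  rw [hφ, aeval_C_mul_eq_pow_mul W γ hg]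

/-- `proto` preserves forms of degree `m`. [folklore] -/
theorem isHomogeneous_proto {m : ℕ} {g : MvPolynomial (Fin 2) R} (hg : g.IsHomogeneous m) :
    (proto m g).IsHomogeneous m :=
  isHomogeneous_aeval_upperSubst hg _ _ _

/-- **The protomorphs are semi-invariants**: for `g` of degree `m ≥ 1`, `j ≤ m` and
`c = (α, β; 0, γ)`, `P_j(g ∘ c) = γ^m (α γ^{m-1})^j · P_j(g)`. [folklore] -/
theorem bcoeff_proto_aeval_upperSubst {R : Type*} [CommRing R] {m : ℕ} (hm : 1 ≤ m)
    {g : MvPolynomial (Fin 2) R} (hg : g.IsHomogeneous m) (α β γ : R) {j : ℕ} (hj : j ≤ m) :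
    bcoeff m j (proto m (aeval (upperSubst α β γ) g)) = γ ^ m * (α * γ ^ (m - 1)) ^ j * bcoeff m j (proto m g) := by
  rw [proto_aeval_upperSubst hm hg, bcoeff, ← C_pow, coeff_C_mul, ← bcoeff,
    bcoeff_aeval_upperSubst (isHomogeneous_proto hg) _ _ _ hj, Finset.sum_range_succ,
    Finset.sum_eq_zero]
  · simp only [zero_add, Nat.sub_self, pow_zero, mul_one, one_pow, Nat.choose_zero_right, Nat.cast_one]
    ring
  · intro i hi
    have : j - i ≠ 0 := by
      have := Finset.mem_range.mp hi
      omega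
    rw [zero_pow this]
    ring

/-- **The explicit expansion of the protomorphs**: for `g` of degree `m` and `j ≤ m`,
`P_j(g) = ∑_{i ≤ j} b_i (m b_0)^i (-b_1)^{j-i} C(m-i, j-i)`. [folklore] -/
theorem bcoeff_proto {m : ℕ} {g : MvPolynomial (Fin 2) R} (hg : g.IsHomogeneous m) {j : ℕ} (hj : j ≤ m) :
    bcoeff m j (proto m g) =
      ∑ i ∈ Finset.range (j + 1), bcoeff m i g * ((m : R) * bcoeff m 0 g) ^ i *
        (-bcoeff m 1 g) ^ (j - i) * ((m - i).choose (j - i) : R) := by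
  rw [proto, bcoeff_aeval_upperSubst hg _ _ _ hj]
  exact Finset.sum_congr rfl fun i _ => by rw [one_pow, mul_one]

/-- `P_0(g) = b_0`. [folklore] -/
theorem bcoeff_proto_zero {m : ℕ} {g : MvPolynomial (Fin 2) R} (hg : g.IsHomogeneous m) :
    bcoeff m 0 (proto m g) = bcoeff m 0 g := by
  rw [bcoeff_proto hg (Nat.zero_le m), Finset.sum_range_one]
  simp

/-- `P_1(g) = 0`: the normalisation kills the coefficient of `s t^{m-1}`. [folklore] -/
theorem bcoeff_proto_one {m : ℕ} (hm : 1 ≤ m) {g : MvPolynomial (Fin 2) R} (hg : g.IsHomogeneous m) :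
    bcoeff m 1 (proto m g) = 0 := by
  rw [bcoeff_proto hg hm, Finset.sum_range_succ, Finset.sum_range_one]
  simp only [Nat.sub_zero, pow_zero, pow_one, Nat.choose_one_right, mul_one, Nat.sub_self,
    Nat.choose_zero_right, Nat.cast_one]
  ring

end Binary

end

end Summit.ValiantsHypothesis.ValiantsHypothesis.Theorems.ValuativeFlip
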